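import Literature.Analysis.PDE.MollifierRate
import Literature.Analysis.ODE.LinearGrowth
import HarnessLib

/-!
# Friedrichs' regularisation of a linear symmetric hyperbolic system: the regularised dynamics
# `∂ₜU = J_ε 𝒫(t) J_ε U` as an ordinary differential equation on `L²(ℝⁿ; W)` (topic `Analysis/PDE`)

Analytic layer of the energy-method existence theory for linear first-order symmetric hyperbolic
systems `∂ₜU = 𝒫(t)U`, `𝒫(t)U = Σⱼ Aⱼ(t, x) ∂ⱼU + B(t, x) U` (Friedrichs 1954), built to discharge
the named fact `Literature.Geometry.Lorentzian.KerrSchild.waveCauchyProblem`. Following Friedrichs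
(and the modern accounts: Taylor, *PDE III*, Ch. 16, §1, (1.9)–(1.15); Lax 2006, Ch. 6), the
equation is regularised to `∂ₜU = J_ε 𝒫(t) J_ε U`, `J_ε` the mollifier of scale `ε`, which is an
ordinary differential equation with **bounded** right-hand side on the Hilbert space
`L²(ℝⁿ; W)` and is solved globally in time; this file constructs that dynamics and the smooth
representatives of its solutions on which all estimates are then performed:

* `mulOpField`, `opL2` — for continuous bounded coefficient fields `Aⱼ, B` and a smooth compactly
  supported kernel `ρ`, the bounded operator `U ↦ 𝒫(ρ ⋆ U)` on `L²` (`‖𝒫(ρ ⋆ U)‖₂ ≤ Λ ‖U‖₂`,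
  `Λ = M (Σⱼ ∫|∂ⱼρ| + ∫|ρ|)`, Young), its representative `foOp A B (ρ ⋆ ⇑U)`
  (`coeFn_opL2`), and its Lipschitz dependence on the coefficients (`norm_opL2_sub_opL2_le`);
* `IsSymmCoeffFamily` — time-dependent admissible coefficients: at each time admissible symmetric
  coefficients of every order with bounds uniform on compact time intervals, and Lipschitz in
  time, uniformly in space, at order zero;
* `regOp`, `exists_regularised_solution` — the regularised operator `J_ε 𝒫(t) J_ε` on `L²` and the
  global solution `U_ε : ℝ → L²` of `U' = J_ε 𝒫(t) J_ε U`, `U(0) = U₀` (the tree's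
  `Literature.Analysis.ODE.exists_solution_of_linearGrowth`).

The smooth representatives, the energy identities and the bounds uniform in `ε` are in the sequel
files. Everything is proved; no named fact and no `sorry` is introduced.

## References

* K. O. Friedrichs, *Symmetric hyperbolic linear differential equations*, Comm. Pure Appl. Math.
  7 (1954) 345–392, §§1–3. [Friedrichs1954]
* M. E. Taylor, *Partial Differential Equations III*, 2nd ed., Springer 2011, Ch. 16, §1
  ((1.9)–(1.15): the mollified equation `∂ₜu_ε = J_ε L J_ε u_ε` as a Banach-space ODE).
  [TaylorPDEIII2011]
* P. D. Lax, *Hyperbolic Partial Differential Equations*, AMS 2006, Ch. 6. [Lax2006]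
-/

noncomputable section

open MeasureTheory Set Function Filter Metric ContinuousLinearMap
open scoped ContDiff Topology RealInnerProductSpace ENNReal NNReal Convolution

namespace Literature.Analysis.PDE

open Literature.Analysis.FunctionSpaces Literature.Analysis.ODE

variable {ι : Type*} [Fintype ι]
variable {W : Type*} [NormedAddCommGroup W] [InnerProductSpace ℝ W]

/-! ### Measurability of operator fields applied to fields -/

omit [InnerProductSpace ℝ W] in
/-- A continuous operator field applied to an a.e.-strongly measurable field is a.e.-strongly
measurable. [folklore] -/
theorem aestronglyMeasurable_clm_apply [NormedSpace ℝ W] {C : EuclideanSpace ℝ ι → (W →L[ℝ] W)}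
    (hC : Continuous C) {f : EuclideanSpace ℝ ι → W}
    (hf : AEStronglyMeasurable f (volume : Measure (EuclideanSpace ℝ ι))) :
    AEStronglyMeasurable (fun x ↦ C x (f x)) (volume : Measure (EuclideanSpace ℝ ι)) := by
  have happ : Continuous fun p : (W →L[ℝ] W) × W ↦ p.1 p.2 := isBoundedBilinearMap_apply.continuous
  exact happ.comp_aestronglyMeasurable (hC.aestronglyMeasurable.prodMk hf)

/-! ### The operator `U ↦ 𝒫(ρ ⋆ U)` on `L²` -/

section OpL2

variable {A : ι → EuclideanSpace ℝ ι → (W →L[ℝ] W)} {B : EuclideanSpace ℝ ι → (W →L[ℝ] W)}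
  {M : ℝ} {ρ : EuclideanSpace ℝ ι → ℝ}

/-- **Order-zero coefficient data**: continuity of the coefficient fields and a common bound `M`
for their operator norms (no symmetry and no derivative bounds are needed to *define* the
regularised operator). [cite: Friedrichs1954, §1] -/
structure IsBddCoeff (M : ℝ) (A : ι → EuclideanSpace ℝ ι → (W →L[ℝ] W))
    (B : EuclideanSpace ℝ ι → (W →L[ℝ] W)) : Prop where
  /-- Continuity of the `Aⱼ`. -/
  contA : ∀ j, Continuous (A j)
  /-- Continuity of `B`. -/
  contB : Continuous B
  /-- `0 ≤ M`. -/
  nonneg : 0 ≤ M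
  /-- `‖Aⱼ(x)‖ ≤ M`. -/
  boundA : ∀ j x, ‖A j x‖ ≤ M
  /-- `‖B(x)‖ ≤ M`. -/
  boundB : ∀ x, ‖B x‖ ≤ M

/-- Admissible symmetric coefficients (of any order) are bounded coefficient data. [folklore] -/
theorem IsSymmCoeff.isBddCoeff {k : ℕ} (h : IsSymmCoeff k M A B) : IsBddCoeff M A B where
  contA j := (h.smoothA j).continuous
  contB := h.smoothB.continuous
  nonneg := h.nonneg
  boundA j x := by simpa using h.boundA j [] (by simp) x
  boundB x := by simpa using h.boundB [] (by simp) x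

/-- The constant `Λ(ρ) = Σⱼ ∫|∂ⱼρ| + ∫|ρ|` governing the norm of `U ↦ 𝒫(ρ ⋆ U)` on `L²`.
[folklore] -/
def kernelConst (ρ : EuclideanSpace ℝ ι → ℝ) : ℝ :=
  (∑ j, ∫ y, |fderiv ℝ ρ y (bv j)|) + ∫ y, |ρ y|

/-- `0 ≤ Λ(ρ)`. [folklore] -/
theorem kernelConst_nonneg (ρ : EuclideanSpace ℝ ι → ℝ) : 0 ≤ kernelConst ρ :=
  add_nonneg (Finset.sum_nonneg fun _ _ ↦ integral_nonneg fun _ ↦ abs_nonneg _)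
    (integral_nonneg fun _ ↦ abs_nonneg _)

/-- **`𝒫(ρ ⋆ f)` is in `L²` with `‖𝒫(ρ ⋆ f)‖₂ ≤ M Λ(ρ) ‖f‖₂`** for bounded continuous coefficients,
a smooth compactly supported kernel and `f ∈ L²`: the derivatives fall on the kernel
(`∂ⱼ(ρ ⋆ f) = (∂ⱼρ) ⋆ f`) and Young's inequality applies termwise.
[cite: Friedrichs1954, §3] -/
theorem memLp_foOp_convolution (hc : IsBddCoeff M A B) (hρ : ContDiff ℝ ∞ ρ)
    (hρc : HasCompactSupport ρ) {f : EuclideanSpace ℝ ι → W}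
    (hf : MemLp f 2 (volume : Measure (EuclideanSpace ℝ ι))) :
    MemLp (foOp A B (ρ ⋆[lsmul ℝ ℝ, volume] f)) 2 (volume : Measure (EuclideanSpace ℝ ι)) ∧
      l2norm (foOp A B (ρ ⋆[lsmul ℝ ℝ, volume] f)) ≤ M * kernelConst ρ * l2norm f := by
  have hfl : LocallyIntegrable f (volume : Measure (EuclideanSpace ℝ ι)) := hf.locallyIntegrable one_le_two
  set V : EuclideanSpace ℝ ι → W := ρ ⋆[lsmul ℝ ℝ, volume] f with hV
  have hVs : ContDiff ℝ ∞ V := contDiff_convolution_kernel hρ hρc hfl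
  -- the derivative terms
  have hderiv : ∀ j, (fun x ↦ fderiv ℝ V x (bv j)) = (fun y ↦ fderiv ℝ ρ y (bv j)) ⋆[lsmul ℝ ℝ, volume] f := by
    intro j
    have h := cwd_convolution_eq_convolution_cwd_kernel hρ hρc hfl [j]
    simpa [cwd_singleton] using h
  have hρj : ∀ j, Continuous fun y ↦ fderiv ℝ ρ y (bv j) := fun j ↦
    (hρ.continuous_fderiv (by simp)).clm_apply continuous_const
  have hρjc : ∀ j, HasCompactSupport fun y ↦ fderiv ℝ ρ y (bv j) := fun j ↦ hρc.fderiv_apply (𝕜 := ℝ) (bv j)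
  have hAj : ∀ j, MemLp (fun x ↦ A j x (fderiv ℝ V x (bv j))) 2 (volume : Measure (EuclideanSpace ℝ ι)) ∧
      l2norm (fun x ↦ A j x (fderiv ℝ V x (bv j))) ≤ M * ((∫ y, |fderiv ℝ ρ y (bv j)|) * l2norm f) := by
    intro j
    obtain ⟨hm, hle⟩ := memLp_convolution_kernel (hρj j) (hρjc j) hf
    rw [← hderiv j] at hm hle
    obtain ⟨hm2, hle2⟩ := memLp_clm_apply_and_l2norm_le (hc.contA j)
      ((hVs.continuous_fderiv (by simp)).clm_apply continuous_const) hm hc.nonneg (hc.boundA j)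
    exact ⟨hm2, hle2.trans (mul_le_mul_of_nonneg_left hle hc.nonneg)⟩
  -- the zeroth-order term
  obtain ⟨hVm, hVle⟩ := memLp_convolution_kernel hρ.continuous hρc hf
  obtain ⟨hBm, hBle⟩ := memLp_clm_apply_and_l2norm_le hc.contB hVs.continuous hVm hc.nonneg hc.boundB
  -- the sum of the derivative terms
  classical
  have key : ∀ s : Finset ι, MemLp (fun x ↦ ∑ j ∈ s, A j x (fderiv ℝ V x (bv j))) 2
      (volume : Measure (EuclideanSpace ℝ ι)) ∧
      l2norm (fun x ↦ ∑ j ∈ s, A j x (fderiv ℝ V x (bv j))) ≤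
        ∑ j ∈ s, M * ((∫ y, |fderiv ℝ ρ y (bv j)|) * l2norm f) := by
    intro s
    induction s using Finset.induction_on with
    | empty => exact ⟨by simp, by simp [l2norm_def]⟩
    | insert j s hj ih =>
      have heq : (fun x ↦ ∑ i ∈ insert j s, A i x (fderiv ℝ V x (bv i))) =
          (fun x ↦ A j x (fderiv ℝ V x (bv j))) + fun x ↦ ∑ i ∈ s, A i x (fderiv ℝ V x (bv i)) := by
        funext x; simp [Finset.sum_insert hj]
      rw [heq, Finset.sum_insert hj]
      exact ⟨(hAj j).1.add ih.1, (l2norm_add_le (hAj j).1 ih.1).trans (add_le_add (hAj j).2 ih.2)⟩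
  obtain ⟨hSm, hsum_le⟩ := key Finset.univ
  have hfo : foOp A B V = (fun x ↦ ∑ j, A j x (fderiv ℝ V x (bv j))) + fun x ↦ B x (V x) := by
    funext x; rfl
  rw [hfo]
  refine ⟨hSm.add hBm, (l2norm_add_le hSm hBm).trans ?_⟩
  calc l2norm (fun x ↦ ∑ j, A j x (fderiv ℝ V x (bv j))) + l2norm (fun x ↦ B x (V x))
      ≤ (∑ j, M * ((∫ y, |fderiv ℝ ρ y (bv j)|) * l2norm f)) + M * ((∫ y, |ρ y|) * l2norm f) :=
        add_le_add hsum_le (hBle.trans (mul_le_mul_of_nonneg_left hVle hc.nonneg))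
    _ = M * kernelConst ρ * l2norm f := by
        rw [kernelConst, ← Finset.mul_sum, ← Finset.sum_mul]; ring

omit [Fintype ι] in
/-- Bounded coefficient data are closed under differences, with bound the sup of the
differences (continuity of the difference fields). [folklore] -/
theorem IsBddCoeff.sub {A' : ι → EuclideanSpace ℝ ι → (W →L[ℝ] W)}
    {B' : EuclideanSpace ℝ ι → (W →L[ℝ] W)} {M' η : ℝ} (hc : IsBddCoeff M A B)
    (hc' : IsBddCoeff M' A' B') (hη : 0 ≤ η) (hA : ∀ j x, ‖A j x - A' j x‖ ≤ η)
    (hB : ∀ x, ‖B x - B' x‖ ≤ η) :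
    IsBddCoeff η (fun j x ↦ A j x - A' j x) (fun x ↦ B x - B' x) where
  contA j := (hc.contA j).sub (hc'.contA j)
  contB := hc.contB.sub hc'.contB
  nonneg := hη
  boundA := hA
  boundB := hB

/-- `foOp` is linear in the coefficients: the difference of the operators with coefficients
`(A, B)` and `(A', B')` is the operator with coefficients `(A − A', B − B')`. [folklore] -/
theorem foOp_sub_foOp {A' : ι → EuclideanSpace ℝ ι → (W →L[ℝ] W)}
    {B' : EuclideanSpace ℝ ι → (W →L[ℝ] W)} (U : EuclideanSpace ℝ ι → W) :
    (fun x ↦ foOp A B U x - foOp A' B' U x) =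
      foOp (fun j x ↦ A j x - A' j x) (fun x ↦ B x - B' x) U := by
  funext x
  simp only [foOp_apply, _root_.sub_apply, Finset.sum_sub_distrib]
  abel

/-- `foOp` is additive in the field (for differentiable fields). [folklore] -/
theorem foOp_add {U V : EuclideanSpace ℝ ι → W} (hU : Differentiable ℝ U) (hV : Differentiable ℝ V) :
    foOp A B (U + V) = foOp A B U + foOp A B V := by
  funext x
  simp only [foOp_apply, Pi.add_apply, fderiv_add (hU x) (hV x), _root_.add_apply,
    map_add, Finset.sum_add_distrib]
  abel

/-- `foOp` commutes with scalars (for differentiable fields). [folklore] -/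
theorem foOp_smul {U : EuclideanSpace ℝ ι → W} (hU : Differentiable ℝ U) (c : ℝ) :
    foOp A B (c • U) = c • foOp A B U := by
  funext x
  simp only [foOp_apply, Pi.smul_apply, fderiv_const_smul (hU x) c, FunLike.coe_smul,
    map_smul, Finset.smul_sum, smul_add]

variable (A B) in
/-- **The operator `U ↦ 𝒫(ρ ⋆ U)` on `L²(ℝⁿ; W)`** for bounded continuous coefficients and a smooth
compactly supported kernel: a bounded linear operator of norm `≤ M Λ(ρ)`
(`memLp_foOp_convolution`), with values represented by the smooth fields `foOp A B (ρ ⋆ ⇑U)`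
(`coeFn_opL2`). This is the operator `L J_ε` of Friedrichs' mollified equation.
[cite: Friedrichs1954, §3] -/
def opL2 (hc : IsBddCoeff M A B) (hρ : ContDiff ℝ ∞ ρ) (hρc : HasCompactSupport ρ) :
    Lp W 2 (volume : Measure (EuclideanSpace ℝ ι)) →L[ℝ] Lp W 2 (volume : Measure (EuclideanSpace ℝ ι)) :=
  LinearMap.mkContinuous
    { toFun := fun U ↦ (memLp_foOp_convolution hc hρ hρc (Lp.memLp U)).1.toLp _
      map_add' := fun U V ↦ by
        have hU := Lp.memLp U
        have hV := Lp.memLp V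
        have hexU : ConvolutionExists ρ (U : EuclideanSpace ℝ ι → W) (lsmul ℝ ℝ) volume :=
          hρc.convolutionExists_left _ hρ.continuous (hU.locallyIntegrable one_le_two)
        have hexV : ConvolutionExists ρ (V : EuclideanSpace ℝ ι → W) (lsmul ℝ ℝ) volume :=
          hρc.convolutionExists_left _ hρ.continuous (hV.locallyIntegrable one_le_two)
        have hdU : Differentiable ℝ (ρ ⋆[lsmul ℝ ℝ, volume] (U : EuclideanSpace ℝ ι → W)) :=
          (contDiff_convolution_kernel hρ hρc (hU.locallyIntegrable one_le_two)).differentiable (by simp)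
        have hdV : Differentiable ℝ (ρ ⋆[lsmul ℝ ℝ, volume] (V : EuclideanSpace ℝ ι → W)) :=
          (contDiff_convolution_kernel hρ hρc (hV.locallyIntegrable one_le_two)).differentiable (by simp)
        have heq : foOp A B (ρ ⋆[lsmul ℝ ℝ, volume] ((U + V : Lp W 2 volume) : EuclideanSpace ℝ ι → W)) =
            foOp A B (ρ ⋆[lsmul ℝ ℝ, volume] (U : EuclideanSpace ℝ ι → W)) +
              foOp A B (ρ ⋆[lsmul ℝ ℝ, volume] (V : EuclideanSpace ℝ ι → W)) := by
          rw [convolution_kernel_congr_ae (Lp.coeFn_add U V), hexU.distrib_add hexV, foOp_add hdU hdV]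
        rw [← MemLp.toLp_add]
        exact MemLp.toLp_congr _ _ (Eventually.of_forall fun x ↦ by rw [heq])
      map_smul' := fun c U ↦ by
        have hU := Lp.memLp U
        have hdU : Differentiable ℝ (ρ ⋆[lsmul ℝ ℝ, volume] (U : EuclideanSpace ℝ ι → W)) :=
          (contDiff_convolution_kernel hρ hρc (hU.locallyIntegrable one_le_two)).differentiable (by simp)
        have heq : foOp A B (ρ ⋆[lsmul ℝ ℝ, volume] ((c • U : Lp W 2 volume) : EuclideanSpace ℝ ι → W)) =
            c • foOp A B (ρ ⋆[lsmul ℝ ℝ, volume] (U : EuclideanSpace ℝ ι → W)) := by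
          rw [convolution_kernel_congr_ae (Lp.coeFn_smul c U), convolution_smul, foOp_smul hdU]
        rw [RingHom.id_apply, ← MemLp.toLp_const_smul]
        exact MemLp.toLp_congr _ _ (Eventually.of_forall fun x ↦ by rw [heq]) }
    (M * kernelConst ρ) fun U ↦ by
      simp only [LinearMap.coe_mk, AddHom.coe_mk, Lp.norm_toLp]
      have h := (memLp_foOp_convolution hc hρ hρc (Lp.memLp U)).2
      rw [l2norm_def, l2norm_def] at h
      rwa [Lp.norm_def]

/-- The values of `opL2` are represented by `foOp A B (ρ ⋆ ⇑U)` almost everywhere. [folklore] -/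
theorem coeFn_opL2 (hc : IsBddCoeff M A B) (hρ : ContDiff ℝ ∞ ρ) (hρc : HasCompactSupport ρ)
    (U : Lp W 2 (volume : Measure (EuclideanSpace ℝ ι))) :
    (opL2 A B hc hρ hρc U : EuclideanSpace ℝ ι → W) =ᵐ[(volume : Measure (EuclideanSpace ℝ ι))]
      foOp A B (ρ ⋆[lsmul ℝ ℝ, volume] (U : EuclideanSpace ℝ ι → W)) :=
  MemLp.coeFn_toLp (memLp_foOp_convolution hc hρ hρc (Lp.memLp U)).1

/-- Norm of a value of `opL2`: the `L²` norm of the representative. [folklore] -/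
theorem norm_opL2_eq (hc : IsBddCoeff M A B) (hρ : ContDiff ℝ ∞ ρ) (hρc : HasCompactSupport ρ)
    (U : Lp W 2 (volume : Measure (EuclideanSpace ℝ ι))) :
    ‖opL2 A B hc hρ hρc U‖ = l2norm (foOp A B (ρ ⋆[lsmul ℝ ℝ, volume] (U : EuclideanSpace ℝ ι → W))) :=
  Lp.norm_toLp _ (memLp_foOp_convolution hc hρ hρc (Lp.memLp U)).1

/-- **Operator bound**: `‖𝒫(ρ ⋆ U)‖₂ ≤ M Λ(ρ) ‖U‖₂`. [cite: Friedrichs1954, §3] -/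
theorem norm_opL2_le (hc : IsBddCoeff M A B) (hρ : ContDiff ℝ ∞ ρ) (hρc : HasCompactSupport ρ)
    (U : Lp W 2 (volume : Measure (EuclideanSpace ℝ ι))) :
    ‖opL2 A B hc hρ hρc U‖ ≤ M * kernelConst ρ * ‖U‖ := by
  rw [norm_opL2_eq, Lp.norm_def, ← l2norm_def]
  exact (memLp_foOp_convolution hc hρ hρc (Lp.memLp U)).2

/-- **Lipschitz dependence on the coefficients**: if `‖Aⱼ − A'ⱼ‖, ‖B − B'‖ ≤ η` pointwise then
`‖𝒫(ρ ⋆ U) − 𝒫'(ρ ⋆ U)‖₂ ≤ η Λ(ρ) ‖U‖₂`. This gives the continuity in time of the regularised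
operator. [cite: Friedrichs1954, §3] -/
theorem norm_opL2_sub_opL2_le {A' : ι → EuclideanSpace ℝ ι → (W →L[ℝ] W)}
    {B' : EuclideanSpace ℝ ι → (W →L[ℝ] W)} {M' η : ℝ} (hc : IsBddCoeff M A B)
    (hc' : IsBddCoeff M' A' B') (hρ : ContDiff ℝ ∞ ρ) (hρc : HasCompactSupport ρ) (hη : 0 ≤ η)
    (hA : ∀ j x, ‖A j x - A' j x‖ ≤ η) (hB : ∀ x, ‖B x - B' x‖ ≤ η)
    (U : Lp W 2 (volume : Measure (EuclideanSpace ℝ ι))) :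
    ‖opL2 A B hc hρ hρc U - opL2 A' B' hc' hρ hρc U‖ ≤ η * kernelConst ρ * ‖U‖ := by
  have hsub := hc.sub hc' hη hA hB
  have hmem := (memLp_foOp_convolution hc hρ hρc (Lp.memLp U)).1
  have hmem' := (memLp_foOp_convolution hc' hρ hρc (Lp.memLp U)).1
  obtain ⟨hmemd, hle⟩ := memLp_foOp_convolution hsub hρ hρc (Lp.memLp U)
  have heq : opL2 A B hc hρ hρc U - opL2 A' B' hc' hρ hρc U =
      hmemd.toLp (foOp (fun j x ↦ A j x - A' j x) (fun x ↦ B x - B' x)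
        (ρ ⋆[lsmul ℝ ℝ, volume] (U : EuclideanSpace ℝ ι → W))) := by
    change hmem.toLp _ - hmem'.toLp _ = _
    rw [← MemLp.toLp_sub]
    exact MemLp.toLp_congr _ _ (Eventually.of_forall fun x ↦ by
      rw [← foOp_sub_foOp]; rfl)
  rw [heq, Lp.norm_toLp, ← l2norm_def, Lp.norm_def, ← l2norm_def]
  exact hle

end OpL2

/-! ### Time-dependent admissible coefficients -/

section Family

variable {A : ι → ℝ → EuclideanSpace ℝ ι → (W →L[ℝ] W)} {B : ℝ → EuclideanSpace ℝ ι → (W →L[ℝ] W)}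

/-- **Time-dependent admissible symmetric coefficients.** At every time the frozen coefficients
`(Aⱼ(t, ·), B(t, ·))` are admissible symmetric coefficients of every order `k`, with bounds uniform
on compact time intervals; and at order zero the coefficients are Lipschitz in time, uniformly in
space, on compact time intervals (Friedrichs 1954, §1: coefficients with bounded derivatives;
the time-Lipschitz bound makes `t ↦ J_ε 𝒫(t) J_ε` norm-continuous). [cite: Friedrichs1954, §1] -/
structure IsSymmCoeffFamily (A : ι → ℝ → EuclideanSpace ℝ ι → (W →L[ℝ] W))
    (B : ℝ → EuclideanSpace ℝ ι → (W →L[ℝ] W)) : Prop where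
  /-- Frozen-time admissibility of every order, uniformly on compact time intervals. -/
  coeff : ∀ (T : ℝ) (k : ℕ), ∃ M, ∀ t ∈ Icc (-T) T, IsSymmCoeff k M (fun j ↦ A j t) (B t)
  /-- Lipschitz continuity in time at order zero, uniformly in space. -/
  lip : ∀ T : ℝ, ∃ L, 0 ≤ L ∧ ∀ s ∈ Icc (-T) T, ∀ t ∈ Icc (-T) T, ∀ x,
    (∀ j, ‖A j t x - A j s x‖ ≤ L * |t - s|) ∧ ‖B t x - B s x‖ ≤ L * |t - s|

/-- Frozen-time admissibility at a single time. [folklore] -/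
theorem IsSymmCoeffFamily.exists_coeff (h : IsSymmCoeffFamily A B) (t : ℝ) (k : ℕ) :
    ∃ M, IsSymmCoeff k M (fun j ↦ A j t) (B t) := by
  obtain ⟨M, hM⟩ := h.coeff |t| k
  exact ⟨M, hM t ⟨neg_abs_le t, le_abs_self t⟩⟩

/-- The order-zero bound at time `t` (a definite choice, for use in definitions). [folklore] -/
def IsSymmCoeffFamily.bound (h : IsSymmCoeffFamily A B) (t : ℝ) : ℝ :=
  Classical.choose (h.exists_coeff t 0)

/-- The frozen coefficients at time `t` are bounded coefficient data with bound `h.bound t`.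
[folklore] -/
theorem IsSymmCoeffFamily.isBddCoeff (h : IsSymmCoeffFamily A B) (t : ℝ) :
    IsBddCoeff (h.bound t) (fun j ↦ A j t) (B t) :=
  (Classical.choose_spec (h.exists_coeff t 0)).isBddCoeff

end Family

/-! ### The mollifier of scale `ε` -/

section Scale

variable (ι)

/-- The bump function of scale `ε > 0`: inner radius `ε/2`, outer radius `ε`. [folklore] -/
def bump {ε : ℝ} (hε : 0 < ε) : ContDiffBump (0 : EuclideanSpace ℝ ι) :=
  ⟨ε / 2, ε, by positivity, by linarith⟩

/-- The mollifier `ρ_ε = (bump ε).normed`: smooth, nonnegative, unit mass, supported in the ball of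
radius `ε`, even. [cite: Friedrichs1954, §3] -/
def moll {ε : ℝ} (hε : 0 < ε) : EuclideanSpace ℝ ι → ℝ :=
  (bump ι hε).normed volume

variable {ι}

omit [Fintype ι] in
/-- The outer radius of the bump of scale `ε` is `ε`. [folklore] -/
@[simp]
theorem bump_rOut {ε : ℝ} (hε : 0 < ε) : (bump ι hε).rOut = ε := rfl

/-- The mollifier of scale `ε` is smooth. [folklore] -/
theorem contDiff_moll {ε : ℝ} (hε : 0 < ε) : ContDiff ℝ ∞ (moll ι hε) :=
  (bump ι hε).contDiff_normed

/-- The mollifier of scale `ε` has compact support. [folklore] -/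
theorem hasCompactSupport_moll {ε : ℝ} (hε : 0 < ε) : HasCompactSupport (moll ι hε) :=
  (bump ι hε).hasCompactSupport_normed

/-- The mollifier of scale `ε` is continuous. [folklore] -/
theorem continuous_moll {ε : ℝ} (hε : 0 < ε) : Continuous (moll ι hε) :=
  (contDiff_moll hε).continuous

/-- The mollifier of scale `ε` is even. [folklore] -/
theorem moll_neg {ε : ℝ} (hε : 0 < ε) (x : EuclideanSpace ℝ ι) : moll ι hε (-x) = moll ι hε x :=
  (bump ι hε).normed_neg x

/-- The mollifier of scale `ε` is nonnegative. [folklore] -/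
theorem moll_nonneg {ε : ℝ} (hε : 0 < ε) (x : EuclideanSpace ℝ ι) : 0 ≤ moll ι hε x :=
  (bump ι hε).nonneg_normed x

/-- The mollifier of scale `ε` has unit mass. [folklore] -/
theorem integral_moll {ε : ℝ} (hε : 0 < ε) : ∫ x, moll ι hε x = 1 :=
  (bump ι hε).integral_normed

end Scale

/-! ### The regularised operator `J_ε 𝒫(t) J_ε` and the regularised dynamics -/

section RegOp

variable {A : ι → ℝ → EuclideanSpace ℝ ι → (W →L[ℝ] W)} {B : ℝ → EuclideanSpace ℝ ι → (W →L[ℝ] W)}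

/-- The mollifier `J_ε` of scale `ε` as a bounded operator on `L²(ℝⁿ; W)`. [cite: Friedrichs1954, §3] -/
def mollL2 {ε : ℝ} (hε : 0 < ε) :
    Lp W 2 (volume : Measure (EuclideanSpace ℝ ι)) →L[ℝ] Lp W 2 (volume : Measure (EuclideanSpace ℝ ι)) :=
  convL2 (moll ι hε) (continuous_moll hε) (hasCompactSupport_moll hε)

/-- `J_ε` does not increase the `L²` norm. [cite: Friedrichs1954, §3] -/
theorem norm_mollL2_le {ε : ℝ} (hε : 0 < ε) (U : Lp W 2 (volume : Measure (EuclideanSpace ℝ ι))) :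
    ‖mollL2 (W := W) hε U‖ ≤ ‖U‖ := by
  rw [mollL2, norm_convL2_eq, Lp.norm_def, ← l2norm_def]
  exact (memLp_normed_convolution_and_l2norm_le (bump ι hε) (Lp.memLp U)).2

/-- **The regularised operator** `J_ε 𝒫(t) J_ε` on `L²(ℝⁿ; W)` (Friedrichs 1954, §3; Taylor,
*PDE III*, Ch. 16, (1.9)). [cite: Friedrichs1954, §3] -/
def regOp (h : IsSymmCoeffFamily A B) {ε : ℝ} (hε : 0 < ε) (t : ℝ) :
    Lp W 2 (volume : Measure (EuclideanSpace ℝ ι)) →L[ℝ] Lp W 2 (volume : Measure (EuclideanSpace ℝ ι)) :=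
  (mollL2 hε).comp (opL2 (fun j ↦ A j t) (B t) (h.isBddCoeff t) (contDiff_moll hε)
    (hasCompactSupport_moll hε))

/-- The inner operator `𝒫(t) J_ε` of `regOp`. [cite: Friedrichs1954, §3] -/
def preOp (h : IsSymmCoeffFamily A B) {ε : ℝ} (hε : 0 < ε) (t : ℝ) :
    Lp W 2 (volume : Measure (EuclideanSpace ℝ ι)) →L[ℝ] Lp W 2 (volume : Measure (EuclideanSpace ℝ ι)) :=
  opL2 (fun j ↦ A j t) (B t) (h.isBddCoeff t) (contDiff_moll hε) (hasCompactSupport_moll hε)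

/-- `regOp = J_ε ∘ preOp`. [folklore] -/
theorem regOp_apply (h : IsSymmCoeffFamily A B) {ε : ℝ} (hε : 0 < ε) (t : ℝ)
    (U : Lp W 2 (volume : Measure (EuclideanSpace ℝ ι))) :
    regOp h hε t U = mollL2 hε (preOp h hε t U) := rfl

/-- **Uniform bound on compact time intervals**: there is `Λ_T ≥ 0` with
`‖𝒫(t) J_ε U‖ ≤ Λ_T ‖U‖` and `‖J_ε 𝒫(t) J_ε U‖ ≤ Λ_T ‖U‖` for `|t| ≤ T` (bounded right-hand side of
the regularised equation; the norm of a value of `opL2` only depends on the representative, so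
the uniform bound of `IsSymmCoeffFamily.coeff` applies). [cite: Friedrichs1954, §3] -/
theorem exists_norm_regOp_le (h : IsSymmCoeffFamily A B) {ε : ℝ} (hε : 0 < ε) (T : ℝ) :
    ∃ Λ : ℝ, 0 ≤ Λ ∧ ∀ t ∈ Icc (-T) T, ∀ U : Lp W 2 (volume : Measure (EuclideanSpace ℝ ι)),
      ‖preOp h hε t U‖ ≤ Λ * ‖U‖ ∧ ‖regOp h hε t U‖ ≤ Λ * ‖U‖ := by
  by_cases hT : 0 ≤ T
  swap
  · exact ⟨0, le_rfl, fun t ht ↦ absurd (ht.1.trans ht.2) (by linarith)⟩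
  obtain ⟨M, hM⟩ := h.coeff T 0
  have hM0 : 0 ≤ M := (hM 0 ⟨by linarith, hT⟩).nonneg
  refine ⟨M * kernelConst (moll ι hε), mul_nonneg hM0 (kernelConst_nonneg _), fun t ht U ↦ ?_⟩
  have h1 : ‖preOp h hε t U‖ ≤ M * kernelConst (moll ι hε) * ‖U‖ := by
    rw [preOp, norm_opL2_eq, Lp.norm_def, ← l2norm_def]
    exact (memLp_foOp_convolution (hM t ht).isBddCoeff (contDiff_moll hε)
      (hasCompactSupport_moll hε) (Lp.memLp U)).2
  exact ⟨h1, (norm_mollL2_le hε _).trans h1⟩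

/-- **Lipschitz dependence on time**: on `|s|, |t| ≤ T`,
`‖𝒫(t) J_ε U − 𝒫(s) J_ε U‖ ≤ L_T Λ(ρ_ε) |t − s| ‖U‖`. [cite: Friedrichs1954, §3] -/
theorem exists_norm_preOp_sub_le (h : IsSymmCoeffFamily A B) {ε : ℝ} (hε : 0 < ε) (T : ℝ) :
    ∃ C : ℝ, 0 ≤ C ∧ ∀ s ∈ Icc (-T) T, ∀ t ∈ Icc (-T) T,
      ∀ U : Lp W 2 (volume : Measure (EuclideanSpace ℝ ι)),
        ‖preOp h hε t U - preOp h hε s U‖ ≤ C * |t - s| * ‖U‖ := by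
  obtain ⟨L, hL0, hL⟩ := h.lip T
  refine ⟨L * kernelConst (moll ι hε), mul_nonneg hL0 (kernelConst_nonneg _), fun s hs t ht U ↦ ?_⟩
  have hη : 0 ≤ L * |t - s| := mul_nonneg hL0 (abs_nonneg _)
  have key := norm_opL2_sub_opL2_le (h.isBddCoeff t) (h.isBddCoeff s) (contDiff_moll hε)
    (hasCompactSupport_moll hε) hη (fun j x ↦ ((hL s hs t ht x).1 j)) (fun x ↦ (hL s hs t ht x).2) U
  calc ‖preOp h hε t U - preOp h hε s U‖ ≤ L * |t - s| * kernelConst (moll ι hε) * ‖U‖ := key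
    _ = L * kernelConst (moll ι hε) * |t - s| * ‖U‖ := by ring

/-- **Continuity in time of the regularised operator** applied to a fixed `U ∈ L²`.
[cite: Friedrichs1954, §3] -/
theorem continuous_regOp_apply (h : IsSymmCoeffFamily A B) {ε : ℝ} (hε : 0 < ε)
    (U : Lp W 2 (volume : Measure (EuclideanSpace ℝ ι))) : Continuous fun t ↦ regOp h hε t U := by
  refine continuous_iff_continuousAt.2 fun t₀ ↦ ?_
  obtain ⟨C, hC0, hC⟩ := exists_norm_preOp_sub_le h hε (|t₀| + 1)
  refine continuousAt_of_locally_lipschitz zero_lt_one (C * ‖U‖) fun t ht ↦ ?_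
  have ht₀ : t₀ ∈ Icc (-(|t₀| + 1)) (|t₀| + 1) := ⟨by linarith [neg_abs_le t₀], by linarith [le_abs_self t₀]⟩
  have htI : t ∈ Icc (-(|t₀| + 1)) (|t₀| + 1) := by
    rw [Real.dist_eq] at ht
    have := abs_lt.1 ht
    exact ⟨by linarith [neg_abs_le t₀], by linarith [le_abs_self t₀]⟩
  rw [dist_eq_norm, regOp_apply, regOp_apply, ← map_sub, Real.dist_eq]
  calc ‖mollL2 hε (preOp h hε t U - preOp h hε t₀ U)‖ ≤ ‖preOp h hε t U - preOp h hε t₀ U‖ :=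
        norm_mollL2_le hε _
    _ ≤ C * |t - t₀| * ‖U‖ := hC t₀ ht₀ t htI U
    _ = C * ‖U‖ * |t - t₀| := by ring

/-- **Global solvability of the regularised equation** (Friedrichs 1954, §3; Taylor, *PDE III*,
Ch. 16, §1, (1.9)–(1.10)): for every `ε > 0` and every `U₀ ∈ L²(ℝⁿ; W)` the linear equation
`U' = J_ε 𝒫(t) J_ε U` with bounded, time-continuous right-hand side has a global solution
`U_ε : ℝ → L²` with `U_ε(0) = U₀` (the tree's linear-growth global existence theorem for
Banach-space ODEs). [cite: Friedrichs1954, §3] -/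
theorem exists_regularised_solution [CompleteSpace W] (h : IsSymmCoeffFamily A B) {ε : ℝ} (hε : 0 < ε)
    (U₀ : Lp W 2 (volume : Measure (EuclideanSpace ℝ ι))) :
    ∃ U : ℝ → Lp W 2 (volume : Measure (EuclideanSpace ℝ ι)),
      U 0 = U₀ ∧ ∀ t, HasDerivAt U (regOp h hε t (U t)) t := by
  refine exists_solution_of_linearGrowth (v := fun t U ↦ regOp h hε t U) (fun T ↦ ?_)
    (fun U ↦ continuous_regOp_apply h hε U) U₀
  obtain ⟨Λ, hΛ0, hΛ⟩ := exists_norm_regOp_le h hε T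
  refine ⟨⟨Λ, hΛ0⟩, fun t ht ↦ ⟨LipschitzWith.of_dist_le_mul fun U V ↦ ?_, fun U ↦ (hΛ t ht U).2⟩⟩
  rw [dist_eq_norm, dist_eq_norm, ← map_sub]
  exact (hΛ t ht (U - V)).2

end RegOp

end Literature.Analysis.PDE

end
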